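import Summits.ResolutionOfSingularities.ResolutionOfSingularities.Theorems.FrobeniusClosingPatchingRelPerfectConeMemberLevelTwoIdeals
import HarnessLib

/-!
# Crux `PatchingRelPerfect` (stmt-ResolutionOfSingularities-16161), chain w52 — R4ˢ INSTANCE:
# the quadric-CONE member AT EXCEPTIONAL DEPTH TWO, `I = (x₀x₁ + x₂²) + 𝔪⁴` — chart ideals

[OURS · L1 W5.2 · rung] CHAIN.md v1.5 §3 lists as NOT covered «two-layer one-form members with
SINGULAR initial scheme (→ R4)».  This is the first such member, the depth-two analogue of rung
r2pt (`…CoreRungConeMember.lean`, `I = (q) + (xᵢ³)`): `S` regular local with regular system of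
parameters `x₀, …, x₃`, `q = x₀x₁ + x₂²` (quadric CONE in `E ≅ ℙ³`, vertex `z₀ = [0:0:0:1]`),
`I = (q) + 𝔪⁴` (`I ⊆ 𝔪²`, `xᵢ⁴ ∈ I`: exceptional depth `ℓ = 2`, GRADED).  On `Bl_𝔪` the residual
is `K = (q̃, u²)` — order two, with the exceptional divisor `E = V(u)` a hypersurface of maximal
contact (`u² ∈ K`).  The companion found here is

  `Q = (P + 𝔪²) · (I + 𝔪² (P + 𝔪²))`,  `P = (x₀, x₁, x₂)`,

and `Bl_{I·Q} Spec S` is the tower of REGULAR centres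

  `Bl_𝔪 S ← Bl_{z₀} ← Bl_{C̃} ← Bl_{C̃' }`

(`z₀` the vertex — a weight-two-PERMISSIBLE centre, `K ≤ 𝔫_{z₀}²`; `C̃ = V(h, u')` the strict
transform of the cone surface `C = V(u, q̃) ⊂ E`, REGULAR after the vertex blow-up, meeting the
strict transform `E' = V(u')` of `E`; `C̃' = V(h', t)` the strict transform of `V(h)` met with the
newest exceptional divisor — the two-step Euclidean tower `(h) + (u'²)` of stub-1's
`…CoreRungTowerCharts.lean`).  This file is the IDENTITIES half, over ANY commutative ring:

* level one (Rees charts `B_i` of `Bl_𝔪`, `u = x_i/1`, `e_j = x_j/x_i`, `F = e₀e₁ + e₂²`):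
  `map_chartBase_I2` (`I B_i = u² (F, u²)`), `map_chartBase_L'` (`(I + 𝔪²(P + 𝔪²)) B_i =
  u² ((F) + u (u, e₀, e₁, e₂))`), `map_chartBase_I2Q` (the product, `u⁵` twisted off);
* level two (charts `C_j` of the blowing up of `c = (t, v₀, v₁, v₂)` in any ring `A`, `w` the
  exceptional parameter, `u' = e'₀`, `G = e'₁e'₂ + e'₃²`): `map_chartBase_LL`, `map_chartBase_KK`,
  `map_chartBase_LK` (`(L K) C_j = w⁴ · (u', G) · ((G) + (u'²))`), `map_chartBase_LK_zero`
  (`(w⁴)` on the `t`-chart), `map_chartBase_LK_succ` (tower shape on the `v_k`-charts);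
* `CoreRungTower.towerTwo_eq` — the two-step tower ideal `∏_{k<2} ((h) + (t, h)ᵏ⁺¹)` of
  `isRegular_of_isBlowup_tower` is `(t, h) · ((h) + (t²))`.

The regularity half and the rung are `…ConeDepthTwo.lean`.  FORMAT evidence for the core only;
nothing here is a statement of the manuscript under review.

## References

* The Stacks Project, Tags 080A, 0804. [StacksProject]
* Q. Liu, *Algebraic Geometry and Arithmetic Curves*, OUP 2002, Thm. 8.1.19 (a). [Liu2002]
* J. Kollár, *Lectures on Resolution of Singularities*, PUP 2007, (3.111) Step 3. [Kollar2007]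
-/

-- `Summit.<Summit>.<Sub>.Theorems` with `Sub = Summit` (single-conjunct summit, D-0017)
set_option linter.dupNamespace false

noncomputable section

open CategoryTheory CategoryTheory.Limits AlgebraicGeometry Literature.AlgebraicGeometry.Resolution
open IsLocalRing

namespace Summit.ResolutionOfSingularities.ResolutionOfSingularities.Theorems

universe u

/-! ## The two-step tower ideal -/

/-- **The two-step Euclidean tower ideal**: for the pair `x' = (t, h)` and the sub-family `(h)`,
`∏_{k<2} ((h) + (t, h)ᵏ⁺¹) = (t, h) · ((h) + (t²))`. [folklore] -/
theorem CoreRungTower.towerTwo_eq {A : Type u} [CommRing A] (t h : A) :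
    ∏ k ∈ Finset.range 2,
      (Ideal.span (Set.range ((Fin.cons t (fun _ : Fin 1 => h) : Fin 2 → A) ∘
          (fun _ : Fin 1 => (1 : Fin 2)))) ⊔
        Ideal.span (Set.range (Fin.cons t (fun _ : Fin 1 => h) : Fin 2 → A)) ^ (k + 1)) =
      Ideal.span {t, h} * (Ideal.span {h} ⊔ Ideal.span {t ^ 2}) := by
  have hsub : Set.range ((Fin.cons t (fun _ : Fin 1 => h) : Fin 2 → A) ∘
      (fun _ : Fin 1 => (1 : Fin 2))) = {h} := by
    ext y
    simp only [Set.mem_range, Function.comp_apply, Set.mem_singleton_iff]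
    constructor
    · rintro ⟨_, rfl⟩; rfl
    · rintro rfl; exact ⟨0, rfl⟩
  have hall : Set.range (Fin.cons t (fun _ : Fin 1 => h) : Fin 2 → A) = {t, h} := by
    rw [Fin.range_cons, Set.range_const]
  rw [hsub, hall, Finset.prod_range_succ, Finset.prod_range_succ, Finset.prod_range_zero, one_mul,
    zero_add, pow_one]
  have h1 : Ideal.span {h} ⊔ Ideal.span ({t, h} : Set A) = Ideal.span {t, h} :=
    sup_eq_right.mpr (Ideal.span_mono (Set.subset_insert _ _))
  have hle : Ideal.span ({t, h} : Set A) ^ 2 ≤ Ideal.span {h} ⊔ Ideal.span {t ^ 2} := by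
    rw [Ideal.span_insert, sq (Ideal.span {t} ⊔ Ideal.span {h}), Ideal.sup_mul, Ideal.mul_sup,
      Ideal.mul_sup, Ideal.span_singleton_mul_span_singleton, ← sq t]
    refine sup_le (sup_le le_sup_right ?_) (sup_le ?_ ?_)
    · exact le_trans Ideal.mul_le_left le_sup_left
    · exact le_trans Ideal.mul_le_right le_sup_left
    · exact le_trans Ideal.mul_le_right le_sup_left
  have hge : Ideal.span {t ^ 2} ≤ Ideal.span ({t, h} : Set A) ^ 2 := by
    rw [Ideal.span_singleton_le_iff_mem, sq, sq]
    exact Ideal.mul_mem_mul (Ideal.subset_span (Set.mem_insert _ _))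
      (Ideal.subset_span (Set.mem_insert _ _))
  have h2 : Ideal.span {h} ⊔ Ideal.span ({t, h} : Set A) ^ 2 =
      Ideal.span {h} ⊔ Ideal.span {t ^ 2} :=
    le_antisymm (sup_le le_sup_left hle) (sup_le le_sup_left (le_trans hge le_sup_right))
  rw [h1, h2]

namespace ConeRung

/-! ## Small ideal algebra -/

/-- `span {a ^ n * b} = span {a} ^ n * span {b}`. [folklore] -/
theorem span_pow_mul {A : Type*} [CommSemiring A] (a b : A) (n : ℕ) :
    Ideal.span {a ^ n * b} = Ideal.span {a} ^ n * Ideal.span {b} := by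
  rw [Ideal.span_singleton_pow, Ideal.span_singleton_mul_span_singleton]

/-! ## Level one: `I = (q) + 𝔪⁴` and the companion factors on the Rees charts of `Bl_𝔪` -/

section LevelOne

variable {S : Type u} [CommRing S] (x : Fin 4 → S) (i : Fin 4)

local notation3 "M" => Ideal.span (Set.range x)
local notation3 "I2" => Ideal.span {x 0 * x 1 + x 2 ^ 2} ⊔ Ideal.span (Set.range x) ^ 4
local notation3 "PP" => Ideal.span {x 0, x 1, x 2}
local notation3 "B" => chartRing x i
local notation3 "φ" => chartBase x i
local notation3 "u" => chartBase x i (x i)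
local notation3 "e[" j "]" => chartGen x i j
local notation3 "F" => chartGen x i 0 * chartGen x i 1 + chartGen x i 2 ^ 2

/-- **`I B_i = u² · ((F) + (u²))`** — exceptional depth two: the residual `K = (F, u²)` contains
the SQUARE of the exceptional parameter. [folklore] -/
theorem map_chartBase_I2 :
    (I2).map φ = Ideal.span {u} ^ 2 * (Ideal.span {F} ⊔ Ideal.span {u} ^ 2) := by
  rw [Ideal.map_sup, Ideal.map_pow, map_chartBase_M, Ideal.map_span, Set.image_singleton,
    chartBase_q, span_pow_mul, Ideal.mul_sup, ← pow_add]

/-- **`(I + 𝔪² (P + 𝔪²)) B_i = u² · ((F) + u · (u, e₀, e₁, e₂))`** (`u² ∈ u (u, e)`).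
[folklore] -/
theorem map_chartBase_L' :
    (I2 ⊔ M ^ 2 * (PP ⊔ M ^ 2)).map φ =
      Ideal.span {u} ^ 2 *
        (Ideal.span {F} ⊔ Ideal.span {u} * Ideal.span {u, e[0], e[1], e[2]}) := by
  rw [Ideal.map_sup, map_chartBase_I2, Ideal.map_mul, Ideal.map_pow, map_chartBase_M,
    map_chartBase_PM, ← Ideal.mul_sup, sup_assoc]
  have hle : Ideal.span {u} ^ 2 ≤ Ideal.span {u} * Ideal.span {u, e[0], e[1], e[2]} := by
    rw [sq]
    exact Ideal.mul_mono_right (Ideal.span_mono (Set.singleton_subset_iff.mpr (Set.mem_insert _ _)))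
  rw [sup_eq_right.mpr hle]

/-- **The total transform of `I · Q`, `Q = (P + 𝔪²) · (I + 𝔪² (P + 𝔪²))`, on every chart:**
`(I Q) B_i = u⁵ · (((F) + u (u, e₀, e₁, e₂)) · ((F) + (u²))) · (u, e₀, e₁, e₂)`. [folklore] -/
theorem map_chartBase_I2Q :
    (I2 * ((PP ⊔ M ^ 2) * (I2 ⊔ M ^ 2 * (PP ⊔ M ^ 2)))).map φ =
      Ideal.span {u ^ 5} *
        (((Ideal.span {F} ⊔ Ideal.span {u} * Ideal.span {u, e[0], e[1], e[2]}) *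
            (Ideal.span {F} ⊔ Ideal.span {u} ^ 2)) *
          Ideal.span {u, e[0], e[1], e[2]}) := by
  rw [Ideal.map_mul, Ideal.map_mul, map_chartBase_I2, map_chartBase_PM, map_chartBase_L',
    ← Ideal.span_singleton_pow]
  ring

/-- On the charts `i = 0, 1, 2` (some `e_j = 1`, `j ≤ 2`): `(u, e₀, e₁, e₂) = (1)`. [folklore] -/
theorem span_u_e_eq_top_of_ne_three (hi : i ≠ 3) : Ideal.span {u, e[0], e[1], e[2]} = ⊤ := by
  have hone : (1 : chartRing x i) ∈ ({u, e[0], e[1], e[2]} : Set (chartRing x i)) := by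
    fin_cases i
    · exact Or.inr (Or.inl (chartGen_self x _).symm)
    · exact Or.inr (Or.inr (Or.inl (chartGen_self x _).symm))
    · exact Or.inr (Or.inr (Or.inr (chartGen_self x _).symm))
    · exact absurd rfl hi
  exact Ideal.eq_top_of_isUnit_mem _ (Ideal.subset_span hone) isUnit_one

/-- **On the charts `i = 0, 1, 2`: `(I Q) B_i = u⁵ · (u, F) · ((F) + (u²))`** — the two-step
Euclidean tower for the pair `(u, F)`. [folklore] -/
theorem map_chartBase_I2Q_of_ne_three (hi : i ≠ 3) :
    (I2 * ((PP ⊔ M ^ 2) * (I2 ⊔ M ^ 2 * (PP ⊔ M ^ 2)))).map φ =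
      Ideal.span {u ^ 5} * (Ideal.span {u, F} * (Ideal.span {F} ⊔ Ideal.span {u ^ 2})) := by
  rw [map_chartBase_I2Q, span_u_e_eq_top_of_ne_three x i hi, Ideal.mul_top, Ideal.mul_top,
    Ideal.span_insert u {F}, sup_comm (Ideal.span {u}) _, Ideal.span_singleton_pow]

end LevelOne

/-! ## Level two: the factors `L = (F) + t (t, v)` and `K = (F) + (t²)` on the charts of
`Bl_{(t, v₀, v₁, v₂)}` -/

section LevelTwo

variable {A : Type u} [CommRing A] (t : A) (v : Fin 3 → A) (j : Fin 4)

local notation3 "cc" => (Fin.cons t v : Fin 4 → A)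
local notation3 "F" => v 0 * v 1 + v 2 ^ 2
local notation3 "LL" => Ideal.span {v 0 * v 1 + v 2 ^ 2} ⊔
  Ideal.span {t} * Ideal.span {t, v 0, v 1, v 2}
local notation3 "KK" => Ideal.span {v 0 * v 1 + v 2 ^ 2} ⊔ Ideal.span {t} ^ 2
local notation3 "C" => chartRing cc j
local notation3 "ψ" => chartBase cc j
local notation3 "w" => chartBase cc j (cc j)
local notation3 "e'[" l "]" => chartGen cc j l
local notation3 "G" => chartGen cc j 1 * chartGen cc j 2 + chartGen cc j 3 ^ 2

/-- `(t, v₀, v₁, v₂) = (c)`. [folklore] -/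
theorem span_t_v_eq : Ideal.span {t, v 0, v 1, v 2} = Ideal.span (Set.range cc) := by
  rw [Fin.range_cons]
  congr 2
  ext y
  simp only [Set.mem_insert_iff, Set.mem_singleton_iff, Set.mem_range]
  constructor
  · rintro (rfl | rfl | rfl)
    · exact ⟨0, rfl⟩
    · exact ⟨1, rfl⟩
    · exact ⟨2, rfl⟩
  · rintro ⟨k, rfl⟩
    fin_cases k
    · exact Or.inl rfl
    · exact Or.inr (Or.inl rfl)
    · exact Or.inr (Or.inr rfl)

/-- `(t, v₀, v₁, v₂) C_j = (w)`. [cite: StacksProject, Tag 0804] -/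
theorem map_chartBase_span_t_v : (Ideal.span {t, v 0, v 1, v 2}).map ψ = Ideal.span {w} := by
  rw [span_t_v_eq]
  exact map_reesChartBase_eq (cc j) (Ideal.mem_span_range_self (f := cc) (x := j))

/-- **`L C_j = w² · ((G) + (u'))`** for `L = (F) + t · (t, v)`. [folklore] -/
theorem map_chartBase_LL :
    (LL).map ψ = Ideal.span {w} ^ 2 * (Ideal.span {G} ⊔ Ideal.span {e'[0]}) := by
  rw [Ideal.map_sup, Ideal.map_mul, Ideal.map_span, Set.image_singleton, chartBase_F_two,
    Ideal.map_span, Set.image_singleton, chartBase_t_two, map_chartBase_span_t_v, span_pow_mul,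
    ← Ideal.span_singleton_mul_span_singleton, mul_assoc, mul_comm (Ideal.span {e'[0]}),
    ← mul_assoc, ← sq, ← Ideal.mul_sup]

/-- **`K C_j = w² · ((G) + (u'²))`** for `K = (F) + (t²)`. [folklore] -/
theorem map_chartBase_KK :
    (KK).map ψ = Ideal.span {w} ^ 2 * (Ideal.span {G} ⊔ Ideal.span {e'[0] ^ 2}) := by
  rw [Ideal.map_sup, Ideal.map_pow, Ideal.map_span, Set.image_singleton, chartBase_F_two,
    Ideal.map_span, Set.image_singleton, chartBase_t_two, span_pow_mul,
    ← Ideal.span_singleton_mul_span_singleton, mul_pow, ← Ideal.mul_sup,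
    Ideal.span_singleton_pow (chartGen cc j 0) 2]

/-- `span {w}² · span {w}² = span {w⁴}`. [folklore] -/
theorem span_sq_mul_span_sq {B : Type*} [CommSemiring B] (b : B) :
    Ideal.span {b} ^ 2 * Ideal.span {b} ^ 2 = Ideal.span {b ^ 4} := by
  rw [← pow_add, Ideal.span_singleton_pow]

/-- **The total transform of `L · K` on the charts of `Bl_{(t, v)}`**:
`(L K) C_j = w⁴ · ((u', G) · ((G) + (u'²)))`. [folklore] -/
theorem map_chartBase_LK :
    (LL * KK).map ψ =
      Ideal.span {w ^ 4} * (Ideal.span {e'[0], G} * (Ideal.span {G} ⊔ Ideal.span {e'[0] ^ 2})) := by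
  rw [Ideal.map_mul, map_chartBase_LL, map_chartBase_KK, mul_mul_mul_comm, span_sq_mul_span_sq,
    Ideal.span_insert (chartGen cc j 0), sup_comm (Ideal.span {e'[0]})]

/-- **On the `t`-chart (`j = 0`) everything is Cartier**: `(L K) C₀ = (w⁴)` (`u' = 1` there).
[folklore] -/
theorem map_chartBase_LK_zero :
    (LL * KK).map (chartBase cc 0) = Ideal.span {chartBase cc 0 (cc 0) ^ 4} := by
  rw [map_chartBase_LK]
  have h1 : chartGen cc 0 0 = 1 := chartGen_self cc 0
  have hu : IsUnit (chartGen cc 0 0) := by rw [h1]; exact isUnit_one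
  have htop : Ideal.span {chartGen cc 0 0,
      chartGen cc 0 1 * chartGen cc 0 2 + chartGen cc 0 3 ^ 2} = ⊤ :=
    Ideal.eq_top_of_isUnit_mem _ (Ideal.subset_span (Or.inl rfl)) hu
  have htop' : Ideal.span {chartGen cc 0 0 ^ 2} = ⊤ :=
    Ideal.eq_top_of_isUnit_mem _ (Ideal.subset_span rfl) (hu.pow 2)
  rw [htop, htop', sup_top_eq, Ideal.top_mul, Ideal.mul_top]

/-- **On the `v_k`-chart (`j = k + 1`)**: `(L K) C_j = w⁴ · ∏_{k<2} ((G) + (u', G)ᵏ⁺¹)` — the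
two-step tower of `isRegular_of_isBlowup_tower` for the pair `(u', G)`. [folklore] -/
theorem map_chartBase_LK_succ (k : Fin 3) :
    (LL * KK).map (chartBase cc (Fin.succ k)) =
      Ideal.span {chartBase cc (Fin.succ k) (cc (Fin.succ k)) ^ 4} *
        ∏ l ∈ Finset.range 2,
          (Ideal.span (Set.range ((Fin.cons (chartGen cc (Fin.succ k) 0)
              (fun _ : Fin 1 => chartGen cc (Fin.succ k) 1 * chartGen cc (Fin.succ k) 2 +
                chartGen cc (Fin.succ k) 3 ^ 2) : Fin 2 → chartRing cc (Fin.succ k)) ∘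
              (fun _ : Fin 1 => (1 : Fin 2)))) ⊔
            Ideal.span (Set.range (Fin.cons (chartGen cc (Fin.succ k) 0)
              (fun _ : Fin 1 => chartGen cc (Fin.succ k) 1 * chartGen cc (Fin.succ k) 2 +
                chartGen cc (Fin.succ k) 3 ^ 2) : Fin 2 → chartRing cc (Fin.succ k))) ^ (l + 1)) := by
  rw [CoreRungTower.towerTwo_eq, map_chartBase_LK]

end LevelTwo

end ConeRung

end Summit.ResolutionOfSingularities.ResolutionOfSingularities.Theorems

end
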